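import Summits.CriticalPhenomena.CardyFormulaZ2.Theorems.CardyRotToConfR2SymmetryUpgrade.Negative.SurgFatFamily
import Summits.CriticalPhenomena.CardyFormulaZ2.Theorems.CardyRotToConfR2SymmetryUpgrade.Negative.SurgConcatSplit
import Summits.CriticalPhenomena.CardyFormulaZ2.Theorems.CardyRotToConfR2SymmetryUpgrade.Negative.SurgStopAtMeasurable
import Literature.Probability.RandomPlanarGeometry.ChordalKSCondition
import HarnessLib

/-!
# Stopping surgery curves at a closed set: deterministic and commuting cases
# (line `germ-label-transport`, crux `stmt-CriticalPhenomena-0698`, stub `stub_fatSurgeryLocal`)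

Curve-stopping half of the restriction-form locality of the fat-germ one-shot surgery
`J = Negative.fatSurgery S` (`SurgFatFamily`). For a closed set `F` and the stopping map
`CurveClass.stopAt F`:

* `measure_preimage_stopAt_eq_of_ae` — two probability laws whose stopped class is a.s. the SAME
  deterministic class give the same mass to every `stopAt F ⁻¹' T`;
* `stopAt_congr_set` — `stopAt F ξ = stopAt F' ξ` when `F`, `F'` agree on a set containing the
  trace of `ξ` (same hit set of every representative);
* `hitParam_eq_of_forall_lt` — the hitting parameter of a curve meeting `F` first at `sg`;
* `ae_stopAt_fatSurgery_eq` — if the surgery chord of a firing domain meets `F` (first at `sg`),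
  then `J D`-a.s. the stopped class is the deterministic class of the chord stopped at `F`
  (Dirac case: `stopAt_mk`; prefixed case: `Negative.stopAt_concat_of_hit` on a.e. suffix, whose
  source is the landing point by chordality of `S`); `ae_stopAt_fatSurgery_eq_chord` — the case
  `sg = 1` (the chord meets `F` only at its landing point): the stopped class is the chord;
* `stopAt_firePrefix_of_forall_notMem` — if the chord misses `F`, stopping commutes with
  prefixing: `stopAt F (firePrefix D ξ) = firePrefix D (stopAt F ξ)` for `ξ` starting at the
  landing point (`Negative.stopAt_concat_of_forall_notMem`);
* `stub_fatSurgeryLocalStop` — the deterministic and the commuting case, bundled (registered helper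
  sub-goal of `stub_fatSurgeryLocal`).

References: G. Lawler, O. Schramm, W. Werner, Acta Math. 187 (2001), Cor. 2.4; M. Aizenman,
A. Burchard, Duke Math. J. 99 (1999), §2.1 (curve space).
-/

noncomputable section

open Set Filter Topology Metric MeasureTheory
open scoped unitInterval

namespace Summit.CriticalPhenomena.CardyFormulaZ2.Theorems.CardyRotToConfR2SymmetryUpgrade

open Literature.Probability.RandomPlanarGeometry
open Literature.Probability.RandomPlanarGeometry.BrownianLoop
open Summit.CriticalPhenomena.CardyFormulaZ2.Theorems.CardyRotToConfR2SymmetryUpgrade.Negative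

namespace FatSurgeryLocal

/-! ### Deterministic stopped classes -/

/-- If the stopped class is a.s. the deterministic class `c ∈ T`, the event `stopAt F ∈ T` is
almost sure. [folklore] -/
theorem measure_preimage_stopAt_of_ae_of_mem {μ : Measure (CurveClass ℂ)} [IsProbabilityMeasure μ]
    {F : Set ℂ} {c : CurveClass ℂ} (hμ : ∀ᵐ γ ∂μ, CurveClass.stopAt F γ = c)
    {T : Set (CurveClass ℂ)} (hc : c ∈ T) : μ (CurveClass.stopAt F ⁻¹' T) = 1 := by
  rw [← measure_univ (μ := μ)]
  refine measure_congr (Filter.eventuallyEq_set.2 ?_)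
  filter_upwards [hμ] with γ hγ
  simp only [mem_preimage, hγ, mem_univ, iff_true]
  exact hc

/-- If the stopped class is a.s. the deterministic class `c ∉ T`, the event `stopAt F ∈ T` is
null. [folklore] -/
theorem measure_preimage_stopAt_of_ae_of_notMem {μ : Measure (CurveClass ℂ)}
    {F : Set ℂ} {c : CurveClass ℂ} (hμ : ∀ᵐ γ ∂μ, CurveClass.stopAt F γ = c)
    {T : Set (CurveClass ℂ)} (hc : c ∉ T) : μ (CurveClass.stopAt F ⁻¹' T) = 0 := by
  rw [← measure_empty (μ := μ)]
  refine measure_congr (Filter.eventuallyEq_set.2 ?_)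
  filter_upwards [hμ] with γ hγ
  simp only [mem_preimage, hγ, mem_empty_iff_false, iff_false]
  exact hc

/-- **Two laws stopped a.s. at the same deterministic class agree on stopped events.**
[folklore] -/
theorem measure_preimage_stopAt_eq_of_ae {μ ν : Measure (CurveClass ℂ)} [IsProbabilityMeasure μ]
    [IsProbabilityMeasure ν] {F : Set ℂ} {c : CurveClass ℂ}
    (hμ : ∀ᵐ γ ∂μ, CurveClass.stopAt F γ = c) (hν : ∀ᵐ γ ∂ν, CurveClass.stopAt F γ = c)
    (T : Set (CurveClass ℂ)) :
    μ (CurveClass.stopAt F ⁻¹' T) = ν (CurveClass.stopAt F ⁻¹' T) := by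
  by_cases hc : c ∈ T
  · rw [measure_preimage_stopAt_of_ae_of_mem hμ hc, measure_preimage_stopAt_of_ae_of_mem hν hc]
  · rw [measure_preimage_stopAt_of_ae_of_notMem hμ hc, measure_preimage_stopAt_of_ae_of_notMem hν hc]

/-- **Stopping only sees `F` along the trace**: if `F` and `F'` have the same points on a set
containing the trace of `ξ`, then `stopAt F ξ = stopAt F' ξ`. [folklore] -/
theorem stopAt_congr_set {F F' K : Set ℂ} (hFF' : ∀ x ∈ K, x ∈ F ↔ x ∈ F') {ξ : CurveClass ℂ}
    (hξ : ξ.range ⊆ K) : CurveClass.stopAt F ξ = CurveClass.stopAt F' ξ := by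
  have hr : ξ.out.range ⊆ K := by rwa [CurveClass.range_out]
  show CurveClass.mk (ξ.out.stopAt F) = CurveClass.mk (ξ.out.stopAt F')
  rw [stopAt_eq_of_hitParam_eq]
  show sInf (ξ.out.hitSet F) = sInf (ξ.out.hitSet F')
  congr 1
  ext t
  simp only [Curve.hitSet, mem_union, mem_setOf_eq]
  refine or_congr ⟨?_, ?_⟩ Iff.rfl
  · rintro ⟨ht, hmem⟩
    exact ⟨ht, (hFF' _ (hr ⟨_, rfl⟩)).1 hmem⟩
  · rintro ⟨ht, hmem⟩
    exact ⟨ht, (hFF' _ (hr ⟨_, rfl⟩)).2 hmem⟩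

/-! ### Hitting parameters -/

/-- A curve avoiding `F` before `sg` and in `F` at `sg` first hits `F` at `sg`. [folklore] -/
theorem hitParam_eq_of_forall_lt {F : Set ℂ} {γ : Curve ℂ} {sg : I}
    (hlt : ∀ t : I, (t : ℝ) < sg → γ t ∉ F) (hmem : γ sg ∈ F) : γ.hitParam F = sg :=
  le_antisymm (Curve.hitParam_le hmem) (le_csInf ⟨1, γ.one_mem_hitSet F⟩ (by
    rintro t (⟨ht, htF⟩ | ht1)
    · by_contra h
      exact hlt ⟨t, ht⟩ (not_le.1 h) htF
    · rw [mem_singleton_iff.1 ht1]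
      exact sg.2.2))

/-! ### Surgery laws stopped during the chord -/

section Surgery

variable {S : ChordalFamily} {D : DobrushinDomain} {F : Set ℂ}

/-- Junction condition of a prefixed curve whose suffix starts at the landing point. [folklore] -/
theorem fireChord_junction {ξ₀ : Curve ℂ} (hsrc : ξ₀.source = firePt D) :
    (fireChord D).toContinuousMap 1 = ξ₀.toContinuousMap 0 := by
  show (fireChord D).target = ξ₀.source
  rw [target_fireChord, hsrc]

/-- **Stopped during the chord.** If the surgery chord of a firing domain first meets the closed
set `F` at the parameter `sg` (and does meet it there), then `fatSurgery S D`-a.s. the stopped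
class is the class of the chord stopped at `F` — a deterministic class. [folklore] -/
theorem ae_stopAt_fatSurgery_eq (hS : S.IsChordal) (h : Fires D.carrier (D.pt 0)) (hF : IsClosed F)
    {sg : I} (hsg : (fireChord D).hitParam F = sg) (hmem : fireChord D sg ∈ F) :
    ∀ᵐ γ ∂(fatSurgery S D), CurveClass.stopAt F γ = CurveClass.mk ((fireChord D).stopAt F) := by
  by_cases hq : firePt D = D.pt 1
  · rw [fatSurgery_of_eq h hq, ae_dirac_eq, eventually_pure]
    exact CurveClass.stopAt_mk_holds F hF _
  · rw [fatSurgery_of_ne h hq]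
    have hmeas : MeasurableSet
        {γ : CurveClass ℂ | CurveClass.stopAt F γ = CurveClass.mk ((fireChord D).stopAt F)} :=
      measurableSet_preimage_stopAt hF (measurableSet_singleton _)
    refine (ae_map_iff (measurable_firePrefix D).aemeasurable hmeas).2 ?_
    filter_upwards [(hS (fireDom h hq)).2] with ξ hξ
    rw [pt_zero_fireDom] at hξ
    obtain ⟨hsrc, -, -⟩ := hξ
    obtain ⟨ξ₀, rfl⟩ := CurveClass.surjective_mk ξ
    rw [CurveClass.source_mk] at hsrc
    rw [firePrefix_mk, mkCM, CurveClass.stopAt_mk_holds F hF,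
      stopAt_concat_of_hit (fireChord_junction hsrc) hsg hmem]

/-- **Stopped at the landing point.** If the surgery chord avoids the closed set `F` before its
landing point `q ∈ F`, then `fatSurgery S D`-a.s. the stopped class is the chord class.
[folklore] -/
theorem ae_stopAt_fatSurgery_eq_chord (hS : S.IsChordal) (h : Fires D.carrier (D.pt 0))
    (hF : IsClosed F) (hlt : ∀ t : I, (t : ℝ) < 1 → fireChord D t ∉ F) (hq : firePt D ∈ F) :
    ∀ᵐ γ ∂(fatSurgery S D), CurveClass.stopAt F γ = CurveClass.mk (fireChord D) := by
  have hmem : fireChord D 1 ∈ F := by rw [← Curve.target_def, target_fireChord]; exact hq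
  have h1 : (fireChord D).hitParam F = (1 : I) :=
    hitParam_eq_of_forall_lt (fun t ht => hlt t (by rwa [Set.Icc.coe_one] at ht)) hmem
  have key := ae_stopAt_fatSurgery_eq hS h hF h1 hmem
  rwa [Curve.stopAt_eq_self_of_hitParam_eq_one (by rw [h1, Set.Icc.coe_one])] at key

/-- **Stopping commutes with prefixing when the chord misses `F`.** For closed `F` avoided by
the whole chord and a class `ξ` starting at the landing point,
`stopAt F (firePrefix D ξ) = firePrefix D (stopAt F ξ)`. [folklore] -/
theorem stopAt_firePrefix_of_forall_notMem (hF : IsClosed F) (hFa : ∀ s, fireChord D s ∉ F)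
    {ξ : CurveClass ℂ} (hξ : ξ.source = firePt D) :
    CurveClass.stopAt F (firePrefix D ξ) = firePrefix D (CurveClass.stopAt F ξ) := by
  obtain ⟨ξ₀, rfl⟩ := CurveClass.surjective_mk ξ
  rw [CurveClass.source_mk] at hξ
  rw [firePrefix_mk, stopAt_concat_of_forall_notMem (fireChord_junction hξ) hF (fun t => hFa t),
    firePrefix]
  rfl

end Surgery

end FatSurgeryLocal

open FatSurgeryLocal in
/-- **Stopping a surgery law at a closed set `F`** (helper sub-goal of `stub_fatSurgeryLocal`): if
the chord of a firing domain meets `F`, first at `sg`, the stopped class is a.s. the deterministic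
class of the chord stopped at `F`; if the chord misses `F`, stopping commutes with prefixing on
classes from the landing point. [folklore] -/
theorem stub_fatSurgeryLocalStop : ∀ (S : ChordalFamily) (D : DobrushinDomain) (F : Set ℂ), S.IsChordal → Summit.CriticalPhenomena.CardyFormulaZ2.Theorems.CardyRotToConfR2SymmetryUpgrade.Negative.Fires D.carrier (D.pt 0) → IsClosed F → (∀ sg : unitInterval, (∀ t : unitInterval, (t : ℝ) < sg → Summit.CriticalPhenomena.CardyFormulaZ2.Theorems.CardyRotToConfR2SymmetryUpgrade.Negative.fireChord D t ∉ F) → Summit.CriticalPhenomena.CardyFormulaZ2.Theorems.CardyRotToConfR2SymmetryUpgrade.Negative.fireChord D sg ∈ F → ∀ᵐ γ ∂(Summit.CriticalPhenomena.CardyFormulaZ2.Theorems.CardyRotToConfR2SymmetryUpgrade.Negative.fatSurgery S D), CurveClass.stopAt F γ = CurveClass.mk ((Summit.CriticalPhenomena.CardyFormulaZ2.Theorems.CardyRotToConfR2SymmetryUpgrade.Negative.fireChord D).stopAt F)) ∧ ((∀ t : unitInterval, Summit.CriticalPhenomena.CardyFormulaZ2.Theorems.CardyRotToConfR2SymmetryUpgrade.Negative.fireChord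 D t ∉ F) → ∀ ξ : CurveClass ℂ, ξ.source = Summit.CriticalPhenomena.CardyFormulaZ2.Theorems.CardyRotToConfR2SymmetryUpgrade.Negative.firePt D → CurveClass.stopAt F (Summit.CriticalPhenomena.CardyFormulaZ2.Theorems.CardyRotToConfR2SymmetryUpgrade.Negative.firePrefix D ξ) = Summit.CriticalPhenomena.CardyFormulaZ2.Theorems.CardyRotToConfR2SymmetryUpgrade.Negative.firePrefix D (CurveClass.stopAt F ξ)) :=
  fun _ _ _ hS h hF =>
    ⟨fun _ hlt hmem => ae_stopAt_fatSurgery_eq hS h hF (hitParam_eq_of_forall_lt hlt hmem) hmem,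
      fun hFa _ hξ => stopAt_firePrefix_of_forall_notMem hF hFa hξ⟩

end Summit.CriticalPhenomena.CardyFormulaZ2.Theorems.CardyRotToConfR2SymmetryUpgrade

end
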